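import Summits.KontsevichZagierPeriods.Zeta5Search.QWedgeCFQKernel

/-!
# CF-Q (3/5): Step 4 — assembly against the very-well-poised sum `Ω`, the identity for `n ≥ 2S+2`

HONEST FRAMING: systematic search; no irrationality claim unless certified.

Cell `pub-zeta5`, TYPER g6.  Part of the Lean proof of **CF-Q** (`WedgeDictionary.QWedgeClosedForm`, the closed form of
Brown–Zudilin's leading coefficient `Q(a)` (arXiv:2210.03391, (17)) on the eight-parameter wedge as a factorial ratio
times a terminating very-well-poised `₉F₈(1)`), found and proved on paper by planner gen-1 g4
(`pub-zeta5-gen-1/PROOF-NOTES-g4.md` §9: trinomial revision → Burchnall–Chaundy/Dougall → Pfaff–Saalschütz ×4 → a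
Pochhammer identity), formalised here.  Files: `QWedgeCFQBasic` (toolkit, the `b`-coordinate double sum, Step 1),
`QWedgeCFQKernel` (Steps 2–3), `QWedgeCFQAssembly` (Step 4, the identity for `n ≥ 2S+2`), `QWedgeCFQInterpolation`
(polynomial interpolation in `n` down to the pair conditions), `QWedgeClosedFormProof` (the dictionary `a ↔ (n,b)` and
`QWedgeClosedForm_holds`).

This file: `OmegaTerm` / `OmegaQ` (the terminating very-well-poised `₉F₈(1)` `Ω(b;n)` with natural-number
parameters; equal to the tree's `omegaVWP (bOfA a)`, file 5), the sign-free Saalschütz constants `S1f`, `S2f`, the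
termwise assembly `G_r M₁(r) M₂(r) = S₁ S₂ Ω_r` (`assembly_term`, factorial form + parity split on `r`), the constant
bookkeeping `const_identity`, and
`cfq_large : 2S+2 ≤ n → L(b;n)·n!·b₁!b₄!b₅!b₆!b₇!·∏_N (n−b_j−b_k)! = ∏_j (n−b_j)!·Ω(b;n)`.
-/

open Finset Polynomial

namespace Summit.KontsevichZagierPeriods.Zeta5Search.CFQ

open Summit.KontsevichZagierPeriods.Zeta5Search.Hypergeometric
open Literature.NumberTheory.Irrationality.BrownZudilin2022 (zchoose)

/-! ## Step 4: assembly against the very-well-poised sum `Ω` -/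

/-- `((N - x - y : ℕ) : ℚ) = N - x - y` when `x + y ≤ N`. -/
theorem natCast_sub_sub {N x y : ℕ} (h : x + y ≤ N) : ((N - x - y : ℕ) : ℚ) = (N : ℚ) - x - y := by
  rw [Nat.sub_sub, Nat.cast_sub h, Nat.cast_add]; ring

/-- `(x)_m` for `x = -N`: `(-1)^m N!/R!` with `R = N - m` (`m ≤ N`). -/
theorem ph_negNat {x : ℚ} (N m R : ℕ) (hx : x = -(N : ℚ)) (hR : R + m = N) :
    ph x m = (-1) ^ m * fq N / fq R := by
  subst hx; unfold fq; rw [ph_neg_nat (by omega), show N - m = R by omega]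

/-- `(x)_m` for `x = N + 1`: `T!/N!` with `T = N + m`. -/
theorem ph_posNat {x : ℚ} (N m T : ℕ) (hx : x = (N : ℚ) + 1) (hT : T = N + m) : ph x m = fq T / fq N := by
  subst hx; subst hT; unfold fq; exact ph_nat_succ N m

/-- Sign-free closed form of `S₁ = ₃F₂(−b₃,−b₄,−b₅; −n, n+1−σ₁; 1)`:
`(n−b₄)!(n−b₅)!(n−b₃)!(n−σ₁)! / ((n−b₃−b₄)!(n−b₃−b₅)! n! (n−b₄−b₅)!)`. -/
noncomputable def S1f (n : ℕ) (b : ℕ → ℕ) : ℚ :=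
  fq (n - b 4) * fq (n - b 5) * fq (n - b 3) * fq (n - (b 3 + b 4 + b 5)) /
    (fq (n - b 3 - b 4) * fq (n - b 3 - b 5) * fq n * fq (n - b 4 - b 5))

/-- Sign-free closed form of `S₂` (parameters `b₇, b₁, b₂`). -/
noncomputable def S2f (n : ℕ) (b : ℕ → ℕ) : ℚ :=
  fq (n - b 1) * fq (n - b 2) * fq (n - b 7) * fq (n - (b 7 + b 1 + b 2)) /
    (fq (n - b 7 - b 1) * fq (n - b 7 - b 2) * fq n * fq (n - b 1 - b 2))

/-- The `m`-th term of `Ω(b;n)`: `(1 − 2m/(n+1))·(−n−1)_m/m!·∏_{j=1}^{7} (−b_j)_m/(b_j−n)_m`. -/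
noncomputable def OmegaTerm (n : ℕ) (b : ℕ → ℕ) (m : ℕ) : ℚ :=
  (1 - 2 * (m : ℚ) / ((n : ℚ) + 1)) * (ph (-(n : ℚ) - 1) m / (m.factorial : ℚ)) *
    ∏ j ∈ range 7, ph (-(b (j + 1) : ℚ)) m / ph ((b (j + 1) : ℚ) - n) m

/-- `Ω(b;n) = Σ_{m ≤ n} OmegaTerm` (the terminating very-well-poised `₉F₈(1)` of CF-M3 / CF-Q). -/
noncomputable def OmegaQ (n : ℕ) (b : ℕ → ℕ) : ℚ := ∑ m ∈ range (n + 1), OmegaTerm n b m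

/-- `OmegaTerm m = 0` when `m` exceeds one of the `b_j`. -/
theorem OmegaTerm_eq_zero {n : ℕ} {b : ℕ → ℕ} {m : ℕ} {j : ℕ} (hj : j < 7) (h : b (j + 1) < m) :
    OmegaTerm n b m = 0 := by
  unfold OmegaTerm
  rw [prod_eq_zero (mem_range.2 hj) (by rw [ph_neg_nat_of_lt h, zero_div])]
  simp

/-- `(-1)^(2r) = 1`. -/
theorem neg_one_pow_two_mul (r : ℕ) : ((-1 : ℚ)) ^ (2 * r) = 1 := by
  rw [pow_mul]; simp

/-- **Termwise assembly** (`r ≤ b_j` for all `j`, `n ≥ 2S+2`): `G_r M₁(r) M₂(r) = S₁ S₂ Ω_r`. -/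
theorem assembly_term {n : ℕ} {b : ℕ → ℕ} {r : ℕ} (hr : ∀ j ∈ range 7, r ≤ b (j + 1))
    (hN : 2 * S7 b + 2 ≤ n) :
    Gr n b r * M1 n b r * M2 n b r = S1f n b * S2f n b * OmegaTerm n b r := by
  have h1 := hr 0 (by simp); have h2 := hr 1 (by simp); have h3 := hr 2 (by simp); have h4 := hr 3 (by simp)
  have h5 := hr 4 (by simp); have h6 := hr 5 (by simp); have h7 := hr 6 (by simp)
  simp only [zero_add, Nat.reduceAdd] at h1 h2 h3 h4 h5 h6 h7
  rw [M1_closed h3 hN, M2_closed h7 hN]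
  unfold S7 at hN
  unfold Gr OmegaTerm S1f S2f
  simp only [prod_range_succ, prod_range_zero, one_mul, zero_add, Nat.reduceAdd]
  -- convert every Pochhammer symbol into factorials
  rw [ph_negNat (n + 1) r (n + 1 - r) (by unfold cPar; push_cast; ring) (by omega),
    ph_negNat (x := -((b 6 : ℕ) : ℚ)) (b 6) r (b 6 - r) rfl (by omega),
    ph_negNat (x := aPar n b) (n - b 6) r (n - b 6 - r)
      (by unfold aPar; rw [Nat.cast_sub (by omega)]; ring) (by omega),
    ph_negNat (x := -((b 3 : ℕ) : ℚ)) (b 3) r (b 3 - r) rfl (by omega),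
    ph_negNat (x := -((b 4 : ℕ) : ℚ)) (b 4) r (b 4 - r) rfl (by omega),
    ph_negNat (x := -((b 5 : ℕ) : ℚ)) (b 5) r (b 5 - r) rfl (by omega),
    ph_negNat (x := -((b 7 : ℕ) : ℚ)) (b 7) r (b 7 - r) rfl (by omega),
    ph_negNat (x := -((b 1 : ℕ) : ℚ)) (b 1) r (b 1 - r) rfl (by omega),
    ph_negNat (x := -((b 2 : ℕ) : ℚ)) (b 2) r (b 2 - r) rfl (by omega),
    ph_posNat (x := (n : ℚ) + 1 - ((b 3 + b 4 + b 5 : ℕ) : ℚ)) (n - (b 3 + b 4 + b 5)) r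
      (n - (b 3 + b 4 + b 5) + r) (by rw [Nat.cast_sub (by omega)]; ring) rfl,
    ph_posNat (x := (n : ℚ) + 1 - ((b 7 + b 1 + b 2 : ℕ) : ℚ)) (n - (b 7 + b 1 + b 2)) r
      (n - (b 7 + b 1 + b 2) + r) (by rw [Nat.cast_sub (by omega)]; ring) rfl,
    ph_negNat (x := cPar n) n (2 * r) (n - 2 * r) rfl (by omega),
    ph_negNat (x := cPar n + (r : ℚ) + ((b 4 : ℕ) : ℚ)) (n - b 4 - r) (b 3 - r) (n - b 3 - b 4)
      (by unfold cPar; rw [natCast_sub_sub (by omega)]; ring) (by omega),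
    ph_negNat (x := cPar n + (r : ℚ) + ((b 5 : ℕ) : ℚ)) (n - b 5 - r) (b 3 - r) (n - b 3 - b 5)
      (by unfold cPar; rw [natCast_sub_sub (by omega)]; ring) (by omega),
    ph_negNat (x := cPar n + 2 * (r : ℚ)) (n - 2 * r) (b 3 - r) (n - b 3 - r)
      (by unfold cPar; rw [Nat.cast_sub (by omega)]; push_cast; ring) (by omega),
    ph_negNat (x := cPar n + ((b 4 : ℕ) : ℚ) + ((b 5 : ℕ) : ℚ)) (n - b 4 - b 5) (b 3 - r)
      (n - (b 3 + b 4 + b 5) + r) (by unfold cPar; rw [natCast_sub_sub (by omega)]; ring) (by omega),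
    ph_negNat (x := cPar n + (r : ℚ) + ((b 1 : ℕ) : ℚ)) (n - b 1 - r) (b 7 - r) (n - b 7 - b 1)
      (by unfold cPar; rw [natCast_sub_sub (by omega)]; ring) (by omega),
    ph_negNat (x := cPar n + (r : ℚ) + ((b 2 : ℕ) : ℚ)) (n - b 2 - r) (b 7 - r) (n - b 7 - b 2)
      (by unfold cPar; rw [natCast_sub_sub (by omega)]; ring) (by omega),
    ph_negNat (x := cPar n + 2 * (r : ℚ)) (n - 2 * r) (b 7 - r) (n - b 7 - r)
      (by unfold cPar; rw [Nat.cast_sub (by omega)]; push_cast; ring) (by omega),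
    ph_negNat (x := cPar n + ((b 1 : ℕ) : ℚ) + ((b 2 : ℕ) : ℚ)) (n - b 1 - b 2) (b 7 - r)
      (n - (b 7 + b 1 + b 2) + r) (by unfold cPar; rw [natCast_sub_sub (by omega)]; ring) (by omega),
    ph_negNat (x := -(n : ℚ) - 1) (n + 1) r (n + 1 - r) (by push_cast; ring) (by omega),
    ph_negNat (x := ((b 1 : ℕ) : ℚ) - n) (n - b 1) r (n - b 1 - r) (by rw [Nat.cast_sub (by omega)]; ring) (by omega),
    ph_negNat (x := ((b 2 : ℕ) : ℚ) - n) (n - b 2) r (n - b 2 - r) (by rw [Nat.cast_sub (by omega)]; ring) (by omega),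
    ph_negNat (x := ((b 3 : ℕ) : ℚ) - n) (n - b 3) r (n - b 3 - r) (by rw [Nat.cast_sub (by omega)]; ring) (by omega),
    ph_negNat (x := ((b 4 : ℕ) : ℚ) - n) (n - b 4) r (n - b 4 - r) (by rw [Nat.cast_sub (by omega)]; ring) (by omega),
    ph_negNat (x := ((b 5 : ℕ) : ℚ) - n) (n - b 5) r (n - b 5 - r) (by rw [Nat.cast_sub (by omega)]; ring) (by omega),
    ph_negNat (x := ((b 6 : ℕ) : ℚ) - n) (n - b 6) r (n - b 6 - r) (by rw [Nat.cast_sub (by omega)]; ring) (by omega),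
    ph_negNat (x := ((b 7 : ℕ) : ℚ) - n) (n - b 7) r (n - b 7 - r) (by rw [Nat.cast_sub (by omega)]; ring) (by omega),
    neg_one_pow_two_mul]
  unfold cPar
  have hn1 : (n : ℚ) + 1 ≠ 0 := by positivity
  have hn1' : -(n : ℚ) - 1 ≠ 0 := by
    have : (0 : ℚ) ≤ n := n.cast_nonneg
    linarith
  have hrf : ((r.factorial : ℕ) : ℚ) ≠ 0 := by positivity
  have hF : ∀ k : ℕ, fq k ≠ 0 := fq_ne_zero
  have := hF (n + 1); have := hF (n + 1 - r); have := hF (b 6); have := hF (b 6 - r); have := hF (n - b 6)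
  have := hF (n - b 6 - r); have := hF (b 3); have := hF (b 3 - r); have := hF (b 4); have := hF (b 4 - r)
  have := hF (b 5); have := hF (b 5 - r); have := hF (b 7); have := hF (b 7 - r); have := hF (b 1)
  have := hF (b 1 - r); have := hF (b 2); have := hF (b 2 - r); have := hF (n - (b 3 + b 4 + b 5))
  have := hF (n - (b 3 + b 4 + b 5) + r); have := hF (n - (b 7 + b 1 + b 2)); have := hF (n - (b 7 + b 1 + b 2) + r)
  have := hF n; have := hF (n - 2 * r); have := hF (n - b 4 - r); have := hF (n - b 3 - b 4)
  have := hF (n - b 5 - r); have := hF (n - b 3 - b 5); have := hF (n - b 3 - r); have := hF (n - b 4 - b 5)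
  have := hF (n - b 1 - r); have := hF (n - b 7 - b 1); have := hF (n - b 2 - r); have := hF (n - b 7 - b 2)
  have := hF (n - b 7 - r); have := hF (n - b 1 - b 2); have := hF (n - b 1); have := hF (n - b 2)
  have := hF (n - b 3); have := hF (n - b 4); have := hF (n - b 5); have := hF (n - b 7)
  obtain hs | hs := neg_one_pow_eq_or ℚ r <;> simp only [hs] <;> field_simp <;> ring

/-- Off the box `r ≤ min_j b_j` both sides of the assembly vanish. -/
theorem assembly_zero {n : ℕ} {b : ℕ → ℕ} {r : ℕ} (hr : ∃ j ∈ range 7, b (j + 1) < r) :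
    Gr n b r * M1 n b r * M2 n b r = 0 ∧ OmegaTerm n b r = 0 := by
  obtain ⟨j, hj, hlt⟩ := hr
  refine ⟨?_, OmegaTerm_eq_zero (mem_range.1 hj) hlt⟩
  rw [mem_range] at hj
  interval_cases j
  · rw [M2_eq_zero (Or.inr (Or.inl hlt))]; ring
  · rw [M2_eq_zero (Or.inr (Or.inr hlt))]; ring
  · rw [M1_eq_zero (Or.inl hlt)]; ring
  · rw [M1_eq_zero (Or.inr (Or.inl hlt))]; ring
  · rw [M1_eq_zero (Or.inr (Or.inr hlt))]; ring
  · rw [Gr_eq_zero hlt]; ring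
  · rw [M2_eq_zero (Or.inl hlt)]; ring

/-- `Ω(b;n) = Σ_{m ≤ b₇} Ω_m` (the terms `m > b₇` vanish). -/
theorem OmegaQ_eq_sum_b7 (n : ℕ) (b : ℕ → ℕ) (h7 : b 7 ≤ n) :
    OmegaQ n b = ∑ m ∈ range (b 7 + 1), OmegaTerm n b m := by
  unfold OmegaQ
  symm
  refine sum_subset (range_subset_range.2 (by omega)) fun m hm hm' => ?_
  rw [mem_range] at hm hm'
  exact OmegaTerm_eq_zero (j := 6) (by norm_num) (by show b 7 < m; omega)

/-- **Steps 1–4 combined** (`n ≥ 2S+2`): `L(b;n) = E · S₁ · S₂ · Ω(b;n)`. -/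
theorem LsumZ_eq_E_S_Omega {n : ℕ} {b : ℕ → ℕ} (hN : 2 * S7 b + 2 ≤ n) :
    (LsumZ n b : ℚ) = Econst n b * S1f n b * S2f n b * OmegaQ n b := by
  rw [LsumZ_eq_sum_Gr hN, OmegaQ_eq_sum_b7 n b (by unfold S7 at hN; omega), mul_sum, mul_sum]
  refine sum_congr rfl fun r hr => ?_
  by_cases h : ∀ j ∈ range 7, r ≤ b (j + 1)
  · rw [assembly_term h hN]; ring
  · push Not at h
    obtain ⟨j, hj, hlt⟩ := h
    obtain ⟨h0, hΩ⟩ := assembly_zero (n := n) (b := b) ⟨j, hj, hlt⟩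
    rw [h0, hΩ]; ring

/-- **The constants**: `E · S₁ · S₂ · n! · b₁!b₄!b₅!b₆!b₇! · ∏_N (n−b_j−b_k)! = ∏_j (n−b_j)!`. -/
theorem const_identity (n : ℕ) (b : ℕ → ℕ) :
    Econst n b * S1f n b * S2f n b *
        (fq n * (fq (b 1) * fq (b 4) * fq (b 5) * fq (b 6) * fq (b 7)) *
          (fq (n - b 1 - b 6) * fq (n - b 1 - b 7) * fq (n - b 2 - b 7) * fq (n - b 3 - b 5) *
            fq (n - b 4 - b 5) * fq (n - b 4 - b 6))) =
      fq (n - b 1) * fq (n - b 2) * fq (n - b 3) * fq (n - b 4) * fq (n - b 5) * fq (n - b 6) * fq (n - b 7) := by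
  unfold Econst S1f S2f
  have e1 : n - b 4 - b 6 = n - b 4 - b 6 := rfl
  rw [show n - b 7 - b 1 = n - b 1 - b 7 by omega, show n - b 7 - b 2 = n - b 2 - b 7 by omega,
    show n - (b 7 + b 1 + b 2) = n - b 7 - b 1 - b 2 by omega, show n - (b 3 + b 4 + b 5) = n - b 3 - b 4 - b 5 by omega]
  have hF : ∀ k : ℕ, fq k ≠ 0 := fq_ne_zero
  have := hF n; have := hF (b 1); have := hF (b 4); have := hF (b 5); have := hF (b 6); have := hF (b 7)
  have := hF (n - b 4); have := hF (n - b 4 - b 6); have := hF (n - b 1); have := hF (n - b 1 - b 6)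
  have := hF (n - b 6); have := hF (n - b 3 - b 4); have := hF (n - b 3 - b 4 - b 5); have := hF (n - b 1 - b 2)
  have := hF (n - b 7 - b 1 - b 2); have := hF (n - b 5); have := hF (n - b 3); have := hF (n - b 3 - b 5)
  have := hF (n - b 4 - b 5); have := hF (n - b 2); have := hF (n - b 7); have := hF (n - b 1 - b 7)
  have := hF (n - b 2 - b 7)
  field_simp

/-- **CF-Q for large `n`** (`n ≥ 2S+2`), in the shape of `QWedgeClosedForm`:
`L(b;n) · n! · b₁!b₄!b₅!b₆!b₇! · ∏_N (n−b_j−b_k)! = ∏_j (n−b_j)! · Ω(b;n)`. -/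
theorem cfq_large {n : ℕ} {b : ℕ → ℕ} (hN : 2 * S7 b + 2 ≤ n) :
    (LsumZ n b : ℚ) * (fq n * (fq (b 1) * fq (b 4) * fq (b 5) * fq (b 6) * fq (b 7)) *
          (fq (n - b 1 - b 6) * fq (n - b 1 - b 7) * fq (n - b 2 - b 7) * fq (n - b 3 - b 5) *
            fq (n - b 4 - b 5) * fq (n - b 4 - b 6))) =
      fq (n - b 1) * fq (n - b 2) * fq (n - b 3) * fq (n - b 4) * fq (n - b 5) * fq (n - b 6) * fq (n - b 7) *
        OmegaQ n b := by
  rw [LsumZ_eq_E_S_Omega hN, ← const_identity n b]; ring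


end Summit.KontsevichZagierPeriods.Zeta5Search.CFQ
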